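import Summits.Ventures.Crystal3D.Theorems.StickyWulffConstantNoReconstructionGainBasalBarlowFilm
import Summits.Ventures.Crystal3D.Theorems.StickyWulffConstantNoReconstructionGainSymmetryOrbit
import HarnessLib

/-!
# Barlow films of ANY `{111}` family within `54.7°` of the normal: the atom, by lattice symmetry

HONEST FRAMING. Part of the venture `Summits/Ventures/Crystal3D` (cell `crystal3d-full`), helper
`--supports` the crux `NoReconstructionGain` (stmt-Ventures-19144, route
`route-Ventures-StickyWulffConstant`), line `adhesion`; continuation of `…BasalBarlowFilm`
(`basalBarlowFilm_adhesion`: films inside `B = Λ₀ ∪ (Λ₀ + w) ∪ (Λ₀ − w)`, normals with `ν₃² > 1/3`).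
Transport by a linear isometry `g` mapping `Λ₀` onto itself:

* `basalCut_cross_le` — the SUBSTRATE-FREE form: in a finite unit packing of basal Barlow positions,
  every `ν`-monotone cut (`P` below, `X \ P` above along `ν`, `ν₃² > 1/3`) has
  `#cross(P, X \ P) ≤ D(X \ P)` — any single-family Barlow HOST (fcc, hcp, dhcp, faulted) cut within
  `54.7°` of its axis has no continuation gain and no film gain (the `Q`-term of the T line's
  `BarlowAdhesionR` is only needed beyond `54.7°`, cf. cf-p2 R30's loose {10·0}/{10·1} cuts);
* `basalBarlowFilm_adhesion_orbit` (**the rung**, `R = 1`, `C = 0`; registered by name): for every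
  lattice symmetry `g`, every unit `ν` with `⟪ν, g e₃⟫² > 1/3` (i.e. `ν` within `54.7°` of the
  `{111}` axis `±g e₃`), every `ρ ≥ 1`, and every finite unit packing `X ⊇ P` around the `ν`-slab
  sample whose film lies in `g B = Λ₀ ∪ (Λ₀ + g w) ∪ (Λ₀ − g w)` and above the cut:
  `#cross(P, X \ P) ≤ contactDeficiency (X \ P)`.

Since every unit vector is within `54.7°` of one of the four `{111}` axes (equality only at the six
cube directions), this says: at every non-cubic normal, every film built on the Barlow positions of
the NEAREST `{111}` family — hcp/dhcp grains, Σ3 twin lamellae, faults reaching the interface,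
islands of both hollow types, in any mixture — gains nothing.

Proof: pull the configuration back by `g⁻¹` (`card_cross_image_of_isometry`,
`contactDeficiency_image_of_isometry` of `…Symmetry`) and apply `basalBarlowFilm_adhesion` at the
normal `g⁻¹ ν`.

WHAT THIS IS NOT: films of a family farther than `54.7°` from `ν` (linear certificates censused,
not proved); films mixing families; rung F-C1 not moved.
-/

noncomputable section

namespace Summit.Ventures.Crystal3D.Theorems

open Summit.Ventures.Crystal3D Finset
open Literature.MathematicalPhysics.StatisticalMechanics (fccStacking barlowOffset orderedContacts
  contactDeficiency)
open scoped InnerProductSpace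

/-- **Substrate-free form: a `ν`-monotone cut of a basal Barlow-position packing never gains.**
For every unit `ν` with `ν₃² > 1/3`, every finite unit packing `X` all of whose balls are basal
Barlow positions (`X ⊆ Λ₀ ∪ (Λ₀ + w) ∪ (Λ₀ − w)`), and every `P ⊆ X` such that every contact between
`P` and `X \ P` goes `ν`-upward (`⟪p, ν⟫ < ⟪q, ν⟫`): `#cross(P, X \ P) ≤ contactDeficiency (X \ P)`.
Any Barlow host of the basal family (fcc, hcp, dhcp, faulted …) cut below its film along such a `ν`
is an instance: in particular such cuts have NO continuation gain. -/
theorem basalCut_cross_le (ν : EuclideanSpace ℝ (Fin 3)) (hν : ‖ν‖ = 1) (hν3 : 1 / 3 < ν 2 ^ 2)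
    (X P : Finset (EuclideanSpace ℝ (Fin 3)))
    (hX : ∀ p ∈ X, ∀ q ∈ X, p ≠ q → 1 ≤ dist p q) (hPX : P ⊆ X)
    (hB : ∀ y ∈ X, y ∈ fccStacking 1 (Real.sqrt (2 / 3)) ∨
      y - barlowOffset 1 ∈ fccStacking 1 (Real.sqrt (2 / 3)) ∨
      y + barlowOffset 1 ∈ fccStacking 1 (Real.sqrt (2 / 3)))
    (hup : ∀ p ∈ P, ∀ q ∈ X \ P, dist q p = 1 → ⟪p, ν⟫_ℝ < ⟪q, ν⟫_ℝ) :
    ((((P ×ˢ (X \ P)).filter fun pq => dist pq.1 pq.2 = 1).card : ℕ) : ℝ) ≤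
      contactDeficiency (X \ P) := by
  classical
  set f : EuclideanSpace ℝ (Fin 3) → ℝ := fun y => ⟪y, ν⟫_ℝ with hf
  set Φ : EuclideanSpace ℝ (Fin 3) → ℤ := fun x => (((X \ P).filter fun y => f y < f x).card : ℤ) with hΦ
  have hmain := cross_le_of_potential X P ∅ hX hPX (empty_subset _) Φ fun q hq => by
    rw [sdiff_empty] at hq
    refine basal_noGainPotential X P hX hPX q Φ ν hν hν3 (fun x hx _ => ?_) (fun x hx _ => ?_)
      (fun p hp hd => hup p hp q hq hd) (fun x hx hd => basal_unit_height (hB q (mem_sdiff.1 hq).1) (hB x hx) hd)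
    · simp only [hΦ]; exact rank_lt_iff (X \ P) f x q hx
    · simp only [hΦ]; exact rank_eq_iff (X \ P) f x q hx hq
  simpa using hmain

/-- **Barlow films of the `{111}` family `g e₃` at normals within `54.7°` of `±g e₃`: the atom**
(`R = 1`, `C = 0`; registered by name on stmt-Ventures-19144). -/
theorem basalBarlowFilm_adhesion_orbit :
    ∃ R C : ℝ, 1 ≤ R ∧ ∀ ν : EuclideanSpace ℝ (Fin 3), ‖ν‖ = 1 → ∀ ρ : ℝ, R ≤ ρ →
      ∀ X P : Finset (EuclideanSpace ℝ (Fin 3)),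
      (∀ p ∈ X, ∀ q ∈ X, p ≠ q → 1 ≤ dist p q) → P ⊆ X →
      (∀ p, p ∈ P ↔ (p ∈ fccStacking 1 (Real.sqrt (2 / 3)) ∧ -(2 * R) ≤ ⟪p, ν⟫_ℝ ∧
        ⟪p, ν⟫_ℝ ≤ -R ∧ ‖p‖ ^ 2 - ⟪p, ν⟫_ℝ ^ 2 ≤ ρ ^ 2)) →
      ∀ g : EuclideanSpace ℝ (Fin 3) ≃ₗᵢ[ℝ] EuclideanSpace ℝ (Fin 3),
      (∀ p ∈ fccStacking 1 (Real.sqrt (2 / 3)), g p ∈ fccStacking 1 (Real.sqrt (2 / 3))) →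
      (∀ p ∈ fccStacking 1 (Real.sqrt (2 / 3)), g.symm p ∈ fccStacking 1 (Real.sqrt (2 / 3))) →
      1 / 3 < ⟪ν, g (EuclideanSpace.single (2 : Fin 3) (1 : ℝ))⟫_ℝ ^ 2 →
      (∀ q ∈ X \ P, q ∈ fccStacking 1 (Real.sqrt (2 / 3)) ∨
        q - g (barlowOffset 1) ∈ fccStacking 1 (Real.sqrt (2 / 3)) ∨
        q + g (barlowOffset 1) ∈ fccStacking 1 (Real.sqrt (2 / 3))) →
      (∀ q ∈ X \ P, -R < ⟪q, ν⟫_ℝ) →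
      ((((P ×ˢ (X \ P)).filter fun pq => dist pq.1 pq.2 = 1).card : ℕ) : ℝ) ≤
        contactDeficiency (X \ P) + C * ρ := by
  classical
  obtain ⟨R, C, hR, h⟩ := basalBarlowFilm_adhesion
  refine ⟨R, C, hR, fun ν hν ρ hρ X P hX hPX hP g hg hg' hν3 hfilm habove => ?_⟩
  -- pull back by `g⁻¹`
  have hgi : Isometry (g.symm : EuclideanSpace ℝ (Fin 3) → EuclideanSpace ℝ (Fin 3)) :=
    g.symm.isometry
  have hinj : Function.Injective (g.symm : EuclideanSpace ℝ (Fin 3) → EuclideanSpace ℝ (Fin 3)) :=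
    g.symm.injective
  set X' := X.image g.symm with hX'
  set P' := P.image g.symm with hP'def
  set ν' := g.symm ν with hν'
  have hsd : X' \ P' = (X \ P).image g.symm := by
    rw [hX', hP'def, image_sdiff_of_injOn hinj.injOn hPX]
  have hXp : ∀ p ∈ X', ∀ q ∈ X', p ≠ q → 1 ≤ dist p q := by
    intro p hp q hq hpq
    obtain ⟨p₀, hp₀, rfl⟩ := mem_image.1 hp
    obtain ⟨q₀, hq₀, rfl⟩ := mem_image.1 hq
    rw [hgi.dist_eq]
    exact hX p₀ hp₀ q₀ hq₀ fun e => hpq (by rw [e])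
  have hPXp : P' ⊆ X' := image_subset_image hPX
  have hinn : ∀ p, ⟪g.symm p, ν'⟫_ℝ = ⟪p, ν⟫_ℝ := fun p => by
    rw [hν', LinearIsometryEquiv.inner_map_map]
  have hνn : ‖ν'‖ = 1 := by rw [hν', LinearIsometryEquiv.norm_map, hν]
  have hPp : ∀ p, p ∈ P' ↔ (p ∈ fccStacking 1 (Real.sqrt (2 / 3)) ∧ -(2 * R) ≤ ⟪p, ν'⟫_ℝ ∧
      ⟪p, ν'⟫_ℝ ≤ -R ∧ ‖p‖ ^ 2 - ⟪p, ν'⟫_ℝ ^ 2 ≤ ρ ^ 2) := by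
    intro p
    rw [hP'def, mem_image]
    constructor
    · rintro ⟨p₀, hp₀, rfl⟩
      obtain ⟨hΛ, h1, h2, h3⟩ := (hP p₀).1 hp₀
      refine ⟨hg' p₀ hΛ, ?_, ?_, ?_⟩
      · rw [hinn]; exact h1
      · rw [hinn]; exact h2
      · rw [hinn, LinearIsometryEquiv.norm_map]; exact h3
    · rintro ⟨hΛ, h1, h2, h3⟩
      have hi : ⟪g p, ν⟫_ℝ = ⟪p, ν'⟫_ℝ := by rw [← hinn (g p), LinearIsometryEquiv.symm_apply_apply]
      refine ⟨g p, (hP (g p)).2 ⟨hg p hΛ, ?_, ?_, ?_⟩, g.symm_apply_apply p⟩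
      · rw [hi]; exact h1
      · rw [hi]; exact h2
      · rw [hi, LinearIsometryEquiv.norm_map]; exact h3
  -- the transported side conditions
  have hν3' : 1 / 3 < ν' 2 ^ 2 := by
    have e : ν' 2 = ⟪ν, g (EuclideanSpace.single (2 : Fin 3) (1 : ℝ))⟫_ℝ := by
      have : ⟪ν', EuclideanSpace.single (2 : Fin 3) (1 : ℝ)⟫_ℝ = ν' 2 := by
        simp [EuclideanSpace.inner_single_right]
      rw [← this, hν', ← g.inner_map_map, LinearIsometryEquiv.apply_symm_apply]
    rw [e]; exact hν3
  have hfilm' : ∀ q ∈ X' \ P', q ∈ fccStacking 1 (Real.sqrt (2 / 3)) ∨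
      q - barlowOffset 1 ∈ fccStacking 1 (Real.sqrt (2 / 3)) ∨
      q + barlowOffset 1 ∈ fccStacking 1 (Real.sqrt (2 / 3)) := by
    intro q hq
    rw [hsd] at hq
    obtain ⟨q₀, hq₀, rfl⟩ := mem_image.1 hq
    rcases hfilm q₀ hq₀ with h0 | h1 | h2
    · exact Or.inl (hg' q₀ h0)
    · refine Or.inr (Or.inl ?_)
      have : g.symm q₀ - barlowOffset 1 = g.symm (q₀ - g (barlowOffset 1)) := by
        rw [map_sub, LinearIsometryEquiv.symm_apply_apply]
      rw [this]; exact hg' _ h1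
    · refine Or.inr (Or.inr ?_)
      have : g.symm q₀ + barlowOffset 1 = g.symm (q₀ + g (barlowOffset 1)) := by
        rw [map_add, LinearIsometryEquiv.symm_apply_apply]
      rw [this]; exact hg' _ h2
  have habove' : ∀ q ∈ X' \ P', -R < ⟪q, ν'⟫_ℝ := by
    intro q hq
    rw [hsd] at hq
    obtain ⟨q₀, hq₀, rfl⟩ := mem_image.1 hq
    rw [hinn]; exact habove q₀ hq₀
  have hmain := h ν' hνn ρ hρ X' P' hXp hPXp hPp hν3' hfilm' habove'
  rw [hsd, hP'def, card_cross_image_of_isometry hgi, contactDeficiency_image_of_isometry hgi]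
    at hmain
  exact hmain

end Summit.Ventures.Crystal3D.Theorems

end
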